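import Summits.KontsevichZagierPeriods.KontsevichZagierPeriods.Theorems.HurwitzMicroSectorsNormalFormPrincipleLevelOne
import Summits.KontsevichZagierPeriods.KontsevichZagierPeriods.Theorems.HurwitzMicroSectorsNormalFormPrincipleSlabASubPtK20
import Summits.KontsevichZagierPeriods.KontsevichZagierPeriods.Theorems.HurwitzMicroSectorsNormalFormPrincipleAlgCarriers
import Summits.KontsevichZagierPeriods.KontsevichZagierPeriods.Theorems.HurwitzMicroSectorsNormalFormPrincipleM2FiveZetaTwo
import Summits.KontsevichZagierPeriods.KontsevichZagierPeriods.Theorems.AperySectorThreeTwo.Negative.Kit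

/-!
# `NormalFormPrinciple` (stmt-KontsevichZagierPeriods-3869), line `SketchIdeator1` — leaf `stub_boxRigidity`:
# weight three, level `K`, totally off resonance: integrating out `y` over `[t/x, 1]` (rule 3)

Registered sub-goal `stokes3` of the layer "Conjecture 1 for the boxes
`[(0,1)³, c x^A y^B z^D/(1 − x^K y^K z^K)]` with pairwise distinct exponents" (lead file
`…Weight3`). After merging `t = xyz` and re-banding, one is left with the nested band
representation `R' = [Σ, h]`, `Σ = {(x,t,y) : 0 < x < 1, 0 ≤ t ≤ x, t/x ≤ y ≤ 1}` (the band over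
the level-`K` triangle `B = {0 < w₀ < 1, 0 ≤ w₁ ≤ w₀}` with fibre `[w₁/w₀, 1]` in the last
coordinate), `h(x,t,y) = c x^{A'} y^{E−1} t^D/(1 − t^K)`, `1 ≤ E ≤ A'`, `c` real algebraic.
ONE Newton–Leibniz move (rule 3, `KZ.newtonLeibnizRel`) along the last coordinate with the primitive
`F(x,t,y) = (c/E) x^{A'} y^E t^D/(1 − t^K)` (`∂F/∂y = h`) replaces `R'` by the base representation
`T = [B, F(·,·,1) − F(·,·,t/x)]`, and the endpoint identity
`F(x,t,1) − F(x,t,t/x) = (c/E)(x^{A'} t^D − x^{A'−E} t^{D+E})/(1 − t^K)` holds because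
`x^{A'} (t/x)^E = x^{A'−E} t^E` for `x ≠ 0`, `E ≤ A'`. The primitive is `ℚ`-semialgebraic on `Σ`
(algebraic constant times a quotient of `ℚ`-polynomials; `1 − t^K > 0` there since `0 ≤ t ≤ x < 1`),
the lower edge `w ↦ w₁/w₀` is `ℚ`-semialgebraic on `B` (`w₀ > 0`), and `w₁/w₀ ≤ 1` on `B`.

References: M. Kontsevich, D. Zagier, *Periods* (2001), §1.2 rule (3). No new definitions.
-/

noncomputable section

open MeasureTheory Set
open Literature.NumberTheory.Transcendental Literature.NumberTheory.Transcendental.KZ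
open Literature.ModelTheory.ExponentialFields (IsSemialgebraic)

namespace Summit.KontsevichZagierPeriods.HurwitzMicroSectors.NormalFormPrinciple.PiBox.Weight3

/-! ### Semialgebraicity with an algebraic coefficient, the primitive along the last coordinate -/

/-- On a `ℚ`-semialgebraic set `B ⊆ ℝⁿ` on which `1 − wᵢ^K ≠ 0`, the function
`w ↦ c · p(w)/(1 − wᵢ^K)` with `p ∈ ℚ[w]` and `c` real algebraic is `ℚ`-semialgebraic: the
constant `c` is (`isSemialgebraicFunOn_const_of_isAlgebraic`) and `p/(1 − wᵢ^K)` is a quotient of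
`ℚ`-polynomials. [cite: BochnakCosteRoy1998, Prop. 2.2.6] -/
theorem w3_stokes_isSemialgebraicFunOn {n : ℕ} (K : ℕ) (i : Fin n) {B : Set (Fin n → ℝ)}
    (hB : IsSemialgebraic ℚ B) (hden : ∀ w ∈ B, (0:ℝ) < 1 - w i ^ K) {c : ℝ}
    (hc : IsAlgebraic ℚ c) (p : MvPolynomial (Fin n) ℚ) :
    IsSemialgebraicFunOn ℚ B (fun w => c * MvPolynomial.aeval w p / (1 - w i ^ K)) := by
  have hq : ∀ w ∈ B,
      MvPolynomial.aeval w (1 - MvPolynomial.X i ^ K : MvPolynomial (Fin n) ℚ) ≠ 0 :=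
    fun w hw => by
    simp only [map_sub, map_one, map_pow, MvPolynomial.aeval_X]
    exact (hden w hw).ne'
  refine (IsSemialgebraicFunOn.mul_holds (isSemialgebraicFunOn_const_of_isAlgebraic hB hc)
    (isSemialgebraicFunOn_aeval_div_aeval hB p (1 - MvPolynomial.X i ^ K) hq)).congr
    fun w _ => ?_
  simp only [Pi.mul_apply, map_sub, map_one, map_pow, MvPolynomial.aeval_X]
  exact (mul_div_assoc _ _ _).symm

/-- The derivative in `y` of the primitive `y ↦ (c/E) x^{A'} y^E t^D/(1 − t^K)` is the integrand
`c x^{A'} y^{E−1} t^D/(1 − t^K)` (`E ≥ 1`, `c` real; `x = w₀`, `t = w₁`). [folklore] -/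
theorem w3_stokes_hasDerivAt (K A' D E : ℕ) (hE : 0 < E) (c : ℝ) (w : Fin 2 → ℝ) (t : ℝ) :
    HasDerivAt (fun s : ℝ => c / (E : ℝ) * (w 0 ^ A' * s ^ E * w 1 ^ D) / (1 - w 1 ^ K))
      (c * (w 0 ^ A' * t ^ (E - 1) * w 1 ^ D) / (1 - w 1 ^ K)) t := by
  have hne : (E : ℝ) ≠ 0 := Nat.cast_ne_zero.2 hE.ne'
  have h := ((((hasDerivAt_pow E t).const_mul (w 0 ^ A')).mul_const (w 1 ^ D)).const_mul
    (c / (E : ℝ))).div_const (1 - w 1 ^ K)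
  refine h.congr_deriv ?_
  rw [show c / (E : ℝ) * (w 0 ^ A' * ((E : ℝ) * t ^ (E - 1)) * w 1 ^ D) =
      c / (E : ℝ) * (E : ℝ) * (w 0 ^ A' * t ^ (E - 1) * w 1 ^ D) by ring, div_mul_cancel₀ _ hne]

/-- The endpoint identity of the Newton–Leibniz move: for `E ≤ A'`, `x ≠ 0` and `c`, `t` real,
`(c/E)(x^{A'} t^D − x^{A'−E} t^{D+E})/(1 − t^K) = F(x,t,1) − F(x,t,t/x)` with
`F(x,t,y) = (c/E) x^{A'} y^E t^D/(1 − t^K)`, because `x^{A'} (t/x)^E = x^{A'−E} t^E`. [folklore] -/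
theorem w3_stokes_endpoint (K A' D E : ℕ) (hEA : E ≤ A') (c : ℝ) (w : Fin 2 → ℝ)
    (h0 : w 0 ≠ 0) :
    c / (E : ℝ) * (w 0 ^ A' * w 1 ^ D - w 0 ^ (A' - E) * w 1 ^ (D + E)) / (1 - w 1 ^ K) =
      c / (E : ℝ) * (w 0 ^ A' * (1:ℝ) ^ E * w 1 ^ D) / (1 - w 1 ^ K) -
        c / (E : ℝ) * (w 0 ^ A' * (w 1 / w 0) ^ E * w 1 ^ D) / (1 - w 1 ^ K) := by
  have hx : w 0 ^ A' * (w 1 / w 0) ^ E = w 0 ^ (A' - E) * w 1 ^ E := by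
    rw [div_pow, ← pow_sub_mul_pow (w 0) hEA]
    field_simp
  rw [one_pow, mul_one, hx, pow_add]
  ring

/-! ### The stub -/

/-- **W4 (integrating out `y` over `[t/x, 1]`, rule 3; registered sub-goal of the weight-three
totally-off-resonance layer of `stub_boxRigidity`).** For `K ≥ 1`, `1 ≤ E ≤ A'` and
`c ∈ ℚ̄ ∩ ℝ`, the nested band representation
`R' = [{0 < x < 1, 0 ≤ t ≤ x, t/x ≤ y ≤ 1}, c x^{A'} y^{E−1} t^D/(1 − t^K)]` (coordinates
`(x,t,y) = (z₀,z₁,z₂)`) and the level-`K` triangle representation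
`T = [{0 < x < 1, 0 ≤ t ≤ x}, (c/E)(x^{A'} t^D − x^{A'−E} t^{D+E})/(1 − t^K)]` differ by ONE
Newton–Leibniz relation along the last coordinate, with the primitive
`F = (c/E) x^{A'} y^E t^D/(1 − t^K)`: `∂F/∂y` is the integrand of `R'` and
`F(·,1) − F(·,t/x) = (c/E)(x^{A'} t^D − x^{A'−E} t^{D+E})/(1 − t^K)`.
[cite: KontsevichZagier2001, §1.2 rule (3)] -/
theorem stokes3 (K : ℕ) (hK : 0 < K) (A' D E : ℕ) (hE : 0 < E) (hEA : E ≤ A') (c : ℝ)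
    (hc : IsAlgebraic ℚ c) (R' : IntegralRep 3) (T : IntegralRep 2)
    (hR'd : R'.domain = KZlog.band
      (KZlog.band {y : Fin 1 → ℝ | 0 < y 0 ∧ y 0 < 1} (fun _ => (0:ℝ)) (fun y => y 0))
      (fun w => w 1 / w 0) (fun _ => (1:ℝ)))
    (hR'i : EqOn R'.integrand (fun z => c * (z 0 ^ A' * z 2 ^ (E - 1) * z 1 ^ D) / (1 - z 1 ^ K))
      R'.domain)
    (hTd : T.domain = KZlog.band {y : Fin 1 → ℝ | 0 < y 0 ∧ y 0 < 1} (fun _ => (0:ℝ)) (fun y => y 0))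
    (hTi : EqOn T.integrand (fun w => c / (E : ℝ) * (w 0 ^ A' * w 1 ^ D - w 0 ^ (A' - E) * w 1 ^ (D + E)) /
      (1 - w 1 ^ K)) T.domain) :
    of R' - of T ∈ relations := by
  -- the base `B = T.domain`, the level-`K` triangle `{0 < w₀ < 1, 0 ≤ w₁ ≤ w₀} ⊆ ℝ²`
  have hτ : IsSemialgebraic ℚ T.domain := T.isSemialgebraic_domain
  have hmemT : ∀ w : Fin 2 → ℝ, w ∈ T.domain ↔ (0 < w 0 ∧ w 0 < 1) ∧ 0 ≤ w 1 ∧ w 1 ≤ w 0 :=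
    fun w => by
    rw [hTd]
    exact Iff.rfl
  -- the nested band `Σ = R'.domain` over `B` with fibre `[w₁/w₀, 1]`
  have hmemR' : ∀ z : Fin 3 → ℝ, z ∈ R'.domain ↔
      ((0 < z 0 ∧ z 0 < 1) ∧ 0 ≤ z 1 ∧ z 1 ≤ z 0) ∧ z 1 / z 0 ≤ z 2 ∧ z 2 ≤ 1 := fun z => by
    rw [hR'd]
    exact Iff.rfl
  -- the level-`K` denominator is positive on the band: `0 ≤ z₁ ≤ z₀ < 1`
  have hden : ∀ z ∈ R'.domain, (0:ℝ) < 1 - z 1 ^ K := fun z hz => by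
    have h := (hmemR' z).1 hz
    exact sub_pos.2 (pow_lt_one₀ h.1.2.1 (h.1.2.2.trans_lt h.1.1.2) (Nat.pos_iff_ne_zero.1 hK))
  -- coordinates of `Fin.snoc`
  have hs0 : ∀ (w : Fin 2 → ℝ) (t : ℝ), (Fin.snoc w t : Fin 3 → ℝ) 0 = w 0 := fun _ _ => rfl
  have hs1 : ∀ (w : Fin 2 → ℝ) (t : ℝ), (Fin.snoc w t : Fin 3 → ℝ) 1 = w 1 := fun _ _ => rfl
  have hs2 : ∀ (w : Fin 2 → ℝ) (t : ℝ), (Fin.snoc w t : Fin 3 → ℝ) 2 = t := fun _ _ => rfl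
  -- fibrewise membership in `Σ`
  have hsnoc : ∀ w ∈ T.domain, ∀ t : ℝ, w 1 / w 0 ≤ t → t ≤ 1 →
      (Fin.snoc w t : Fin 3 → ℝ) ∈ R'.domain := fun w hw t h₁ h₂ => by
    rw [hmemR', hs0, hs1, hs2]
    exact ⟨(hmemT w).1 hw, h₁, h₂⟩
  -- ONE Newton–Leibniz move along `z₂ ∈ [w₁/w₀, 1]` over `B`
  refine newtonLeibnizRel_subset_relations ⟨2, R', T, fun w => w 1 / w 0, fun _ => (1:ℝ),
    fun z => c / (E : ℝ) * (z 0 ^ A' * z 2 ^ E * z 1 ^ D) / (1 - z 1 ^ K),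
    ?_, ?_, (by simpa using isSemialgebraicFunOn_ratCast hτ 1),
    fun w hw => div_le_one_of_le₀ ((hmemT w).1 hw).2.2 ((hmemT w).1 hw).1.1.le,
    ?_, ?_, ?_, ?_, rfl⟩
  · -- the primitive is `c` times a quotient of `ℚ`-polynomials on the band
    refine (w3_stokes_isSemialgebraicFunOn K 1 R'.isSemialgebraic_domain hden hc
      (MvPolynomial.C (1 / (E : ℚ)) *
        (MvPolynomial.X 0 ^ A' * MvPolynomial.X 2 ^ E * MvPolynomial.X 1 ^ D))).congr
      fun z _ => ?_
    simp only [map_mul, map_pow, MvPolynomial.aeval_C, MvPolynomial.aeval_X, eq_ratCast,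
      Rat.cast_div, Rat.cast_one, Rat.cast_natCast]
    ring
  · -- the lower edge `w ↦ w₁/w₀` is a quotient of `ℚ`-polynomials on `B` (`w₀ > 0` there)
    refine (isSemialgebraicFunOn_aeval_div_aeval hτ (MvPolynomial.X 1) (MvPolynomial.X 0)
      fun w hw => ?_).congr fun w _ => by simp
    simpa using ((hmemT w).1 hw).1.1.ne'
  · -- the band over `B` with edges `w₁/w₀ ≤ z₂ ≤ 1`
    rw [hR'd, hTd]
    rfl
  · -- continuity of the primitive on the closed fibre
    intro w _
    simp only [hs0, hs1, hs2]
    exact (by fun_prop : Continuous fun t : ℝ =>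
      c / (E : ℝ) * (w 0 ^ A' * t ^ E * w 1 ^ D) / (1 - w 1 ^ K)).continuousOn
  · -- its derivative on the open fibre is the integrand of `R'`
    intro w hw t ht
    rw [hR'i (hsnoc w hw t ht.1.le ht.2.le)]
    simp only [hs0, hs1, hs2]
    exact w3_stokes_hasDerivAt K A' D E hE c w t
  · -- the endpoint difference: `(c/E)(w₀^{A'} w₁^D − w₀^{A'−E} w₁^{D+E})/(1 − w₁^K)`
    intro w hw
    rw [hTi hw]
    simp only [hs0, hs1, hs2]
    exact w3_stokes_endpoint K A' D E hEA c w ((hmemT w).1 hw).1.1.ne'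

end Summit.KontsevichZagierPeriods.HurwitzMicroSectors.NormalFormPrinciple.PiBox.Weight3
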